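import Summits.BirchSwinnertonDyer.Rank1Residual.X10.RankZeroOfTrivialPSelmer
import Summits.BirchSwinnertonDyer.Rank1Residual.X10.RankOneOfPSelmerOrderP
import Literature.NumberTheory.EllipticCurves.QuadraticTwistSelmerPInfty
import Literature.NumberTheory.EllipticCurves.LFunctionSmulProofs
import HarnessLib

/-!
# The `Sel^(p)`-currency converses for an ARBITRARY Weierstrass model over `ℚ` (e.g. the height
# family's `E_{A,B}`), the reduction hypotheses being read on a globally minimal model
# (cell `b2b-bsdres`, unit `b2b-bsdres-x10` = X10 / N2 lane, GEN 28; GLUE — theorems only, no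
# definition, no named fact of its own, nothing booked)

HONEST FRAMING (run/shared/lean/b2b/bsd-rank1-residual/, verbatim in every file): the goal of the
cell is to DELETE the COMBINATION-SHAPED residual classes of the Birch–Swinnerton-Dyer formula for
ALL analytic-rank `≤ 1` elliptic curves over `ℚ` — "full BSD formula for every rank `≤ 1` curve in
class `C`" assembled STRICTLY from published theorems — so that the rank-`≤ 1` remainder becomes
exactly the CONSTRUCTION-SHAPED classes, which are TYPED (missing-input `Prop`s), NOT attempted.
This is not "finishing BSD". GLUE for the BSD-DENSITY sprint (HOME `cells/density/CONVERSION-QUEUE.md`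
v0, binders `h5` / `h9` of `bsz_rankLeOne_cRank_of_pieces`, lever (γ)); nothing priced or booked; no
mark, tier or count of any residual class moves; the N2 class (X10b @ 3) is untouched.

## Why

The density binders speak about the height-family model `E_{A,B} = shortWeierstrass AB`, which is
NOT globally minimal in general, while every `p`-converse in the tree is stated for a globally
minimal `W` (`[W.IsGloballyMinimal]`: `frobeniusTrace`, `minimalDiscriminantInt`, (ram) are read
there). The siblings `X10/RankZeroOfTrivialPSelmer` and `X10/RankOneOfPSelmerOrderP` split the
deduction so that the `Sel^(p)` step needs NO minimality; this file finishes the transport: for ANY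
elliptic `W/ℚ` and a globally minimal `W'` with `C • W = W'` (every `W` has one,
`hasGlobalMinimalModel_rat_holds`), the hypotheses are placed on `W'` and the `Sel^(p)` datum and the
conclusions on `W` — `corank Sel_{p^∞}` and `ord_{s=1} L` are invariants of the isomorphism class
(`selmerCorank_eq_of_variableChange`, `analyticRank_smul`), `rank E(ℚ)` is read on `W` directly.

* `rank_zero_and_analyticRank_zero_of_selmerGroup_eq_bot_of_skinnerUrban_of_model` (p ≥ 3, S–U);
* `rank_one_and_analyticRank_one_of_natCard_selmerGroup_eq_of_converse_of_model` (any corank-one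
  converse at `(W', p)` as a parameter; Cassels–Tate; GZK).

References: as in the siblings; J. H. Silverman, *AEC* III.3.1(b), VII.1.3(b), X.§4, App. C §16
[SilvermanAEC2009].
-/

set_option autoImplicit false

noncomputable section

open scoped Classical MatrixGroups ModularForm AddSubgroup

open CongruenceSubgroup WeierstrassCurve Literature.NumberTheory.EllipticCurves
  Literature.NumberTheory.EllipticCurves.ModularForms

namespace Summit.BirchSwinnertonDyer.Rank1Residual.X10.PSelmerConversesAnyModel

open Summit.BirchSwinnertonDyer.Rank1Residual.X10.RankZeroOfTrivialPSelmer
  Summit.BirchSwinnertonDyer.Rank1Residual.X10.RankOneOfPSelmerOrderP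

/-- **Rank `0` and analytic rank `0` from `Sel^(p)(E/ℚ) = 0`, for ANY model, `p ≥ 3`, along
Skinner–Urban.** `W/ℚ` any elliptic Weierstrass model, `W'` globally minimal with `C • W = W'`;
at `p ≥ 3`: `W'` good ordinary, `E[p]` irreducible (read on `W'`), (ram) on `W'`; then
`Sel^(p)(W) = 0 ⟹ rank W(ℚ) = 0 ∧ ord_{s=1} L(W, s) = 0`, below `skinner_urban_main_conjecture`
(clause (2)) and `exists_isNewformOf`. Proof: corank `0` for `W` fact-free
(`rank_zero_of_selmerGroup_eq_bot`), transported to `W'` (`selmerCorank_eq_of_variableChange`),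
Skinner–Urban's Thm. 3.6.11 (b) on `W'`, and `ord L` transported back (`analyticRank_smul`).
[cite: SkinnerUrban2014, Thm. 3.6.11 (b) (p. 46)] [cite: SilvermanAEC2009, III.3.1(b) and App. C §16] -/
theorem rank_zero_and_analyticRank_zero_of_selmerGroup_eq_bot_of_skinnerUrban_of_model
    (hmod : exists_isNewformOf)
    (hSU : ∀ (W : WeierstrassCurve ℚ) [W.IsElliptic] [W.IsGloballyMinimal] (p : ℕ) [Fact p.Prime]
      (κ : ZpExtension ℚ p) (γ : Field.absoluteGaloisGroup ℚ) (N : ℕ) [NeZero N]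
      (f : CuspForm (Gamma0 N) 2),
      skinner_urban_main_conjecture W p (κ := κ) (γ := γ) (f := f))
    (W W' : WeierstrassCurve ℚ) [W.IsElliptic] [W'.IsElliptic] [W'.IsGloballyMinimal]
    (C : VariableChange ℚ) (hC : C • W = W') (p : ℕ) [Fact p.Prime] (hp : 3 ≤ p)
    (hgood : W'.HasGoodReductionAtPrime p) (hord : ¬ (p : ℤ) ∣ W'.frobeniusTrace p)
    (hirr : W'.HasIrreducibleModPGaloisRep p)
    (haux : ∃ ℓ : ℕ, ∃ _ : Fact ℓ.Prime, ℓ ≠ p ∧ W'.HasMultiplicativeReductionAtPrime ℓ ∧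
      ¬ p ∣ padicValInt ℓ W'.minimalDiscriminantInt)
    (h : W.selmerGroup p = ⊥) :
    W.mordellWeilRank = 0 ∧ W.analyticRank = 0 := by
  obtain ⟨hrank, -, hcorank⟩ := rank_zero_of_selmerGroup_eq_bot W p h
  have hcorank' : W'.selmerCorank p = 0 := by
    rw [← selmerCorank_eq_of_variableChange p hC]; exact hcorank
  have han' : W'.analyticRank = 0 :=
    SkinnerUrban2014.analyticRank_eq_zero_of_selmerCorank_eq_zero_of_mainConjecture hmod hSU W' p hp
      hgood hord hirr haux hcorank'
  have han : W.analyticRank = 0 := by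
    rw [← analyticRank_smul W C, hC]; exact han'
  exact ⟨hrank, han⟩

/-- The `#Sel^(p)(W) = 1` form of the previous theorem (the binder currency).
[cite: SkinnerUrban2014, Thm. 3.6.11 (b) (p. 46)] -/
theorem rank_zero_and_analyticRank_zero_of_natCard_selmerGroup_eq_one_of_skinnerUrban_of_model
    (hmod : exists_isNewformOf)
    (hSU : ∀ (W : WeierstrassCurve ℚ) [W.IsElliptic] [W.IsGloballyMinimal] (p : ℕ) [Fact p.Prime]
      (κ : ZpExtension ℚ p) (γ : Field.absoluteGaloisGroup ℚ) (N : ℕ) [NeZero N]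
      (f : CuspForm (Gamma0 N) 2),
      skinner_urban_main_conjecture W p (κ := κ) (γ := γ) (f := f))
    (W W' : WeierstrassCurve ℚ) [W.IsElliptic] [W'.IsElliptic] [W'.IsGloballyMinimal]
    (C : VariableChange ℚ) (hC : C • W = W') (p : ℕ) [Fact p.Prime] (hp : 3 ≤ p)
    (hgood : W'.HasGoodReductionAtPrime p) (hord : ¬ (p : ℤ) ∣ W'.frobeniusTrace p)
    (hirr : W'.HasIrreducibleModPGaloisRep p)
    (haux : ∃ ℓ : ℕ, ∃ _ : Fact ℓ.Prime, ℓ ≠ p ∧ W'.HasMultiplicativeReductionAtPrime ℓ ∧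
      ¬ p ∣ padicValInt ℓ W'.minimalDiscriminantInt)
    (h : Nat.card (W.selmerGroup p) = 1) :
    W.mordellWeilRank = 0 ∧ W.analyticRank = 0 := by
  have hbot : W.selmerGroup p = ⊥ := by
    haveI := (Nat.card_eq_one_iff_unique.mp h).1
    exact (W.selmerGroup p).eq_bot_of_subsingleton
  exact rank_zero_and_analyticRank_zero_of_selmerGroup_eq_bot_of_skinnerUrban_of_model hmod hSU W W'
    C hC p hp hgood hord hirr haux hbot

/-- **Rank `1` and analytic rank `1` from `#Sel^(p)(W) = p`, `#W(ℚ)[p] = 1`, for ANY model**, below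
Cassels–Tate (`hCT`), ANY corank-one converse at `(W', p)` for a globally minimal `W'` with
`C • W = W'` (`hconv`, a parameter — W. Zhang 2014 Thm. 1.4 (i) at `p ≥ 5`, BSTW Thm. 1.10 at
`p ∤ 2N`, …) and Gross–Zagier–Kolyvagin (`hGZK`): `rank W(ℚ) = 1 ∧ ord_{s=1} L(W,s) = 1 ∧ Ш(W/ℚ)`
finite. Corank `1` for `W` (`selmerCorank_eq_one_of_natCard_selmerGroup_eq`) is transported to `W'`
(`selmerCorank_eq_of_variableChange`), the converse gives `ord L(W') = 1 = ord L(W)`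
(`analyticRank_smul`), and GZK on `W` gives the rank and `Ш`.
[cite: SilvermanAEC2009, Thm. X.4.14, III.3.1(b), App. C §16] [cite: Darmon2004, Thm. 3.22] -/
theorem rank_one_and_analyticRank_one_of_natCard_selmerGroup_eq_of_converse_of_model
    (hCT : WeierstrassCurve.exists_casselsTate_pairing (K := ℚ))
    (hGZK : rank_eq_analyticRank_of_analyticRank_le_one)
    (W W' : WeierstrassCurve ℚ) [W.IsElliptic] [W'.IsElliptic]
    (C : VariableChange ℚ) (hC : C • W = W') (p : ℕ) [Fact p.Prime]
    (hconv : W'.selmerCorank p = 1 → W'.analyticRank = 1)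
    (hs : Nat.card (W.selmerGroup p) = p) (ht : Nat.card (W.toAffine.Point[(p : ℤ)]) = 1) :
    W.mordellWeilRank = 1 ∧ W.analyticRank = 1 ∧ Finite W.sha := by
  refine rank_one_and_analyticRank_one_of_natCard_selmerGroup_eq_of_converse hCT hGZK W p ?_ hs ht
  intro h1
  have h1' : W'.selmerCorank p = 1 := by rw [← selmerCorank_eq_of_variableChange p hC]; exact h1
  rw [← analyticRank_smul W C, hC]
  exact hconv h1'

end Summit.BirchSwinnertonDyer.Rank1Residual.X10.PSelmerConversesAnyModel

end
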